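import Literature.NumberTheory.LFunctions.NicolasCor21RH
import HarnessLib

/-!
# Nicolas 2012, (2.18) and Prop. 2.1 hold: `Nicolas2012_logf_lower_sharp_holds`, `Nicolas2012_logf_lower_holds`

Topic: `Literature/NumberTheory/LFunctions`. DISCHARGE file (pure proofs, no definition, nothing
asserted) for the two RH-explicit Mertens bounds of `NicolasMertensRH.lean`:

* `Nicolas2012_logf_lower_sharp_holds : Nicolas2012_logf_lower_sharp` — J.-L. Nicolas, Acta Arith.
  155 (2012), display (2.18) (arXiv numbering): under RH, for `x ≥ 599`,
  `−(β+2)/(√x log x) + (2−β)/(√x log² x) − (8+4β)/(√x log³ x) − log(2π)/(x log x) − 2/(x^{2/3} log x)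
   − log³ x/(64π² x) ≤ log f(x)`;
* `Nicolas2012_logf_lower_holds : Nicolas2012_logf_lower` — Prop. 2.1 (2.16) at `x₀ = 10⁹`, through the
  tree's `Nicolas2012_logf_lower_of_sharp`.

The proof is Nicolas's ("collecting the information from (2.1), (1.12), (2.13), (2.14), (2.15), (2.4)
and (2.5)"), every input being a theorem of the tree: Lemma 2.1 (`NicolasK.lemma21_lower`), (1.12) =
Schoenfeld's (6.3) (`Schoenfeld1976_theta_holds`, giving `θ ≥ 4x/5` and the term `log³x/(64π²x)`),
Lemma 2.5 (`NicolasJExplicit.nicolasJ_ge_of_RH`, the explicit formula with `|W| ≤ β`), Lemma 2.2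
(`NicolasFz.Fhalf_le`, `Fthird_le`), and Cor. 2.1 (2.13) in the form `NicolasCor21RH.cor21_upperRH`,
which is where this discharge departs from the printed proof: Nicolas feeds (2.13) with the pointwise
Lemma 2.4 (2.12), whose Case 2 rests on Dusart's table `θ(y) < y` (`y ≤ 8·10¹¹`, (1.13)); the tree
replaces that table on `[2³², ∞)` by an averaged bound for `∫ (ψ(√t) − √t) w₀` from the explicit
formula for `ψ₁` (`NicolasSqrtAverage.lean`) and keeps the kernel computation of Case 1 below `2³²`
(`PsiThetaSmall.lean`). The statement proved is (2.18) verbatim (with `W` replaced by `β`, as vendored).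

Computational dependencies (declared `computational` at the gate): the certified zeros of `ζ` behind
`Schoenfeld1976_theta_holds` (`native_decide`) and the kernel certificate `PsiThetaSmall`.

## References

* J.-L. Nicolas, *Small values of the Euler function and the Riemann hypothesis*, Acta Arith. 155
  (2012), 311–321 (arXiv:1202.0729): (1.12)–(1.14), Lemma 2.1 (2.1), Lemma 2.2 (2.4)–(2.5),
  Cor. 2.1 (2.13), Lemma 2.5 (2.14)–(2.15), Prop. 2.1 (2.16) and display (2.18). [Nicolas2012]
* L. Schoenfeld, Math. Comp. 30 (1976), 337–360, Thm. 10 (6.3). [Schoenfeld1976]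
-/

noncomputable section

open Filter Set MeasureTheory
open scoped Real Chebyshev

namespace Literature.NumberTheory.LFunctions

/-- **Nicolas 2012, (2.18) holds** (the named fact `Nicolas2012_logf_lower_sharp` of
`NicolasMertensRH.lean`): under RH, for `x ≥ 599`,
`−(β+2)/(√x log x) + (2−β)/(√x log² x) − (8+4β)/(√x log³ x) − log(2π)/(x log x) − 2/(x^{2/3} log x)
 − log³ x/(64π² x) ≤ log f(x)`. Nicolas's assembly with Cor. 2.1 supplied by
`NicolasCor21RH.cor21_upperRH` (RH alone, no `θ(y) < y` table). [cite: Nicolas2012, (2.18) (proof of Prop. 2.1)] -/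
theorem Nicolas2012_logf_lower_sharp_holds : Nicolas2012_logf_lower_sharp := by
  intro hRH x hx
  have hx1 : (1 : ℝ) < x := by linarith
  have hS := Schoenfeld1976_theta_holds
  have h21 := NicolasK.lemma21_lower (by linarith : (121 : ℝ) ≤ x)
    (Nicolas2012Sharp.theta_ge_four_fifths hS hRH hx)
  have h213 := NicolasCor21RH.cor21_upperRH hRH hx1
  have hJ := NicolasJExplicit.nicolasJ_ge_of_RH hRH hx1
  have hF2 := NicolasFz.Fhalf_le hx1
  have hF3 := NicolasFz.Fthird_le hx1
  have hS2 := Nicolas2012Sharp.sq_theta_sub_div_le hS hRH hx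
  obtain ⟨a₁, ha₁⟩ : ∃ a : ℝ, a = 1 / (Real.sqrt x * Real.log x) := ⟨_, rfl⟩
  obtain ⟨a₂, ha₂⟩ : ∃ a : ℝ, a = 1 / (Real.sqrt x * Real.log x ^ 2) := ⟨_, rfl⟩
  obtain ⟨a₃, ha₃⟩ : ∃ a : ℝ, a = 1 / (Real.sqrt x * Real.log x ^ 3) := ⟨_, rfl⟩
  obtain ⟨a₅, ha₅⟩ : ∃ a : ℝ, a = 1 / (x ^ ((2 : ℝ) / 3) * Real.log x) := ⟨_, rfl⟩
  have eJ : -nicolasBeta / (Real.sqrt x * Real.log x)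
      - nicolasBeta * ((1 + 4 / Real.log x) / (Real.sqrt x * Real.log x ^ 2))
      - Real.log (2 * π) / (x * Real.log x) =
      -nicolasBeta * a₁ - nicolasBeta * a₂ - 4 * nicolasBeta * a₃ - Real.log (2 * π) / (x * Real.log x) := by
    rw [ha₁, ha₂, ha₃]; ring
  have eF2 : 2 / (Real.sqrt x * Real.log x) - 2 / (Real.sqrt x * Real.log x ^ 2) +
      8 / (Real.sqrt x * Real.log x ^ 3) = 2 * a₁ - 2 * a₂ + 8 * a₃ := by
    rw [ha₁, ha₂, ha₃]; ring
  have eF3 : 3 / (2 * x ^ (2 / 3 : ℝ) * Real.log x) = 3 / 2 * a₅ := by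
    rw [ha₅]; ring
  have eT : -(nicolasBeta + 2) / (√x * Real.log x) + (2 - nicolasBeta) / (√x * Real.log x ^ 2)
      - (8 + 4 * nicolasBeta) / (√x * Real.log x ^ 3) - Real.log (2 * π) / (x * Real.log x)
      - 2 / (x ^ ((2 : ℝ) / 3) * Real.log x) - Real.log x ^ 3 / (64 * π ^ 2 * x) =
      -(nicolasBeta + 2) * a₁ + (2 - nicolasBeta) * a₂ - (8 + 4 * nicolasBeta) * a₃
      - Real.log (2 * π) / (x * Real.log x) - 2 * a₅ - Real.log x ^ 3 / (64 * π ^ 2 * x) := by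
    rw [ha₁, ha₂, ha₃, ha₅]; ring
  rw [eT]
  rw [eJ] at hJ
  rw [eF2] at hF2
  rw [eF3] at hF3
  linarith

/-- **Nicolas 2012, Prop. 2.1 (2.16)–(2.17) at `x₀ = 10⁹` holds** (the named fact `Nicolas2012_logf_lower`
of `NicolasMertensRH.lean`): under RH, for `x ≥ 10⁹`, `−log f(x) ≤ (2 + β)/(√x log x)`; from (2.18)
through the tree's `Nicolas2012_logf_lower_of_sharp`. [cite: Nicolas2012, Prop. 2.1 (2.16)] -/
theorem Nicolas2012_logf_lower_holds : Nicolas2012_logf_lower :=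
  Nicolas2012_logf_lower_of_sharp Nicolas2012_logf_lower_sharp_holds

end Literature.NumberTheory.LFunctions

end
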